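import Summits.AtomisticToContinuum.FouriersLaw.Theorems.BondHeatUncertaintyBoundedResponseOddSectorGreenKubo
import Summits.AtomisticToContinuum.FouriersLaw.Theorems.OddSectorIrreversibilityOddCorrectorDecayWeightMoments
import HarnessLib

/-!
# BondHeatUncertainty / BoundedResponse — «OddTransversality»: the honesty split of the odd-sector door (lens-1 g103 NODE 103)

Blocker 11071 `BoundedResponse` (⟺ `OhmicFloor` ⟺ `ExponentFloor 1`).  Gen 102 landed the TIME-FREE door 102D `OddCorrectorGrade (−1) → BoundedResponse`
(`oddDefect(μ_T^N) h₀ = 4‖h₀^odd‖²_{μ_T} ≤ C/N`), flagged STRONGER-LEANING.  This node makes the flag exact: Pythagoras in `L²(μ_T^N)` relative to the line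
`ℝJ` (`J = ∑_i j_i`, `Θ`-odd) splits `oddDefect h₀ = 4‖P_J h₀^odd‖² + 4·dist²(h₀^odd, ℝJ)`, graded as (JCᶜ_s) `CurrentComponentGrade s` and (OTᶜ_s)
`OddTransversalGrade s` (§0).  §1 TWO-SIDED STATICS on the probability Gibbs measure, `c·N ≤ ‖J‖²_{μ_T^N} ≤ C_J·N` (the floor is the tree's
`ChainVariation.pinnedChain_integral_totalCurrent_sq_ge` via `OddCorrectorBathLocality.exists_const_currentNormSq_ge`, transported along `e^{−H/T}dx = Z·μ_T`).
§2–§4: **`OddCorrectorGrade s ↔ CurrentComponentGrade s ∧ OddTransversalGrade s`** and **`CurrentComponentGrade s ↔ ExponentFloor ((1−s)/2)`** (odd pairing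
`⟨h₀ − h₀∘Θ, J⟩ = −2T²(N−1)E_N`, `0 ≤ E_N`, §1) — the component ALONG `J` is exactly the escape rung and nothing else; hence the graded HONESTY EQUIV
`OddCorrectorGrade s ↔ ExponentFloor ((1−s)/2) ∧ OddTransversalGrade s`, at `s = −1` **`OddCorrectorGrade (−1) ↔ BoundedResponse ∧ OddTransversalGrade (−1)`**
(door 102D = 11071 PLUS a transversal smallness), at `s = 0` `OddCorrectorGrade 0 ↔ HalfOhmicFloor ∧ OddTransversalGrade 0`, with E1 ⟹ (OTᶜ_0).
READING (memo NODE-g103.md, «norm persistence» — the mechanism of the tree's `not_OddCorrectorDecay`): the deterministic bulk transports the `Θ`-odd current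
coherently until the bath influence arrives (`t ≍ N`), so `‖u_N^odd‖² ≍ N²`, `oddDefect(μ_T^N) h₀ ≍ 1` (log–log slope 0): (OTᶜ_s) is predicted TRUE iff `s ≥ 0`;
(O₋₁ᶜ) = 102D predicted FALSE while its rung `F(1)` = 11071 is Fourier-true; the odd-norm / Cauchy–Schwarz ladder tops out at `F(1/2)`.  Instrument-decided
(INSTRUMENT-g103.md).  Tags: (JCᶜ_s) EQUIV · COSTUME of `F((1−s)/2)` (admissible once: the coordinate making the split exact); (OTᶜ_s) NEW piece · UNDECIDED ·
WEAKER than (Oᶜ_s).  0 sorry · standard axioms · tree imports only.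
-/

noncomputable section

open MeasureTheory ProbabilityTheory Filter Topology Set Function
open scoped NNReal ENNReal
open Literature.MathematicalPhysics.KineticTheory.HeatConduction
open Literature.MathematicalPhysics.KineticTheory OscillatorChain
open Summit.AtomisticToContinuum.FouriersLaw.Theorems.SubdiffusiveBondHeat
open Summit.AtomisticToContinuum.FouriersLaw.Theorems.SubdiffusiveBondHeat.EscapeGrading
open Summit.AtomisticToContinuum.FouriersLaw.Theorems.OddSectorIrreversibility

namespace Summit.AtomisticToContinuum.FouriersLaw.Theorems.BoundedResponse.ParityFloor

open Summit.AtomisticToContinuum.FouriersLaw.Theses.BondHeatUncertainty (BoundedResponse)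
open Summit.AtomisticToContinuum.FouriersLaw.Theses.OddSectorIrreversibility (ConeScaleCorrector)
open Summit.AtomisticToContinuum.FouriersLaw.Theorems.NonBallistic (exists_totalCurrent_sq_le)

section OddTransversality

variable {ω₂ lam β γ T : ℝ} {N : ℕ}

/-! ## §0 The two pieces of the odd defect relative to the current line `ℝJ` -/

/-- **(JCᶜ_s) `CurrentComponentGrade s`** — the part of `h₀^odd` ALONG the total current: eventually in `N`,
`⟨h₀ − h₀∘Θ, J⟩²_{μ_T} ≤ C·N^s·‖J‖²_{μ_T}` (`= 4‖P_J h₀^odd‖² ≤ C N^s`).  EQUIVALENT to the rung `ExponentFloor ((1−s)/2)`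
(`currentComponentGrade_iff_exponentFloor`); at `s = −1` to 11071.  Tag: EQUIV · COSTUME of `F((1−s)/2)`. [route statement · this cell] -/
def CurrentComponentGrade (s : ℝ) : Prop :=
  ∀ ω₂ lam β γ : ℝ, 0 < ω₂ → 0 < lam → 0 < β → 0 < γ → ∀ T : ℝ, 0 < T →
    ∃ C : ℝ, ∃ N₀ : ℕ, ∀ (N : ℕ) (hN : 0 < N), N₀ ≤ N →
      (∫ z, (kinCorrector ω₂ lam β γ T N ⟨0, hN⟩ z - kinCorrector ω₂ lam β γ T N ⟨0, hN⟩ (z.1, -z.2)) *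
          (∑ i : Fin N, (pinnedChain ω₂ lam β γ).bondCurrent N i z) ∂((pinnedChain ω₂ lam β γ).gibbsMeasure N T)) ^ 2 ≤
        C * (N : ℝ) ^ s *
          ∫ z, (∑ i : Fin N, (pinnedChain ω₂ lam β γ).bondCurrent N i z) ^ 2 ∂((pinnedChain ω₂ lam β γ).gibbsMeasure N T)

/-- **(OTᶜ_s) `OddTransversalGrade s`** — the part of `h₀^odd` TRANSVERSAL to the current line: eventually in `N`,
`oddDefect(μ_T) h₀ · ‖J‖²_{μ_T} − ⟨h₀ − h₀∘Θ, J⟩²_{μ_T} ≤ C·N^s·‖J‖²_{μ_T}` (`= 4·dist²_{L²(μ_T)}(h₀^odd, ℝJ) ≤ C N^s`; division-free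
Pythagoras form).  Why it might fail (`s < 0`): norm persistence of the deterministic bulk (`not_OddCorrectorDecay`) predicts `dist² ≍ 1`.
Tags: UNDECIDED (predicted TRUE iff `s ≥ 0`) · WEAKER than (Oᶜ_s) · with `F((1−s)/2)` EQUIVALENT to (Oᶜ_s). [route statement · this cell] -/
def OddTransversalGrade (s : ℝ) : Prop :=
  ∀ ω₂ lam β γ : ℝ, 0 < ω₂ → 0 < lam → 0 < β → 0 < γ → ∀ T : ℝ, 0 < T →
    ∃ C : ℝ, ∃ N₀ : ℕ, ∀ (N : ℕ) (hN : 0 < N), N₀ ≤ N →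
      oddDefect ((pinnedChain ω₂ lam β γ).gibbsMeasure N T) (kinCorrector ω₂ lam β γ T N ⟨0, hN⟩) *
            ∫ z, (∑ i : Fin N, (pinnedChain ω₂ lam β γ).bondCurrent N i z) ^ 2 ∂((pinnedChain ω₂ lam β γ).gibbsMeasure N T) -
          (∫ z, (kinCorrector ω₂ lam β γ T N ⟨0, hN⟩ z - kinCorrector ω₂ lam β γ T N ⟨0, hN⟩ (z.1, -z.2)) *
            (∑ i : Fin N, (pinnedChain ω₂ lam β γ).bondCurrent N i z) ∂((pinnedChain ω₂ lam β γ).gibbsMeasure N T)) ^ 2 ≤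
        C * (N : ℝ) ^ s *
          ∫ z, (∑ i : Fin N, (pinnedChain ω₂ lam β γ).bondCurrent N i z) ^ 2 ∂((pinnedChain ω₂ lam β γ).gibbsMeasure N T)

/-! ## §1 Two-sided statics of the current on the probability Gibbs measure: `c·N ≤ ‖J‖²_{μ_T^N} ≤ C_J·N` -/

/-- Upper statics on `μ_T^N` (probability): `‖J‖²_{μ_T^N} ≤ C_J N` for all `N` (`NonBallistic.exists_totalCurrent_sq_le`, `e^{−H/T}dx = Z·μ_T`). [folklore] -/
theorem exists_integral_totalCurrent_sq_gibbsMeasure_le (hω : 0 < ω₂) (hl : 0 < lam) (hβ : 0 < β) (hT : 0 < T) :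
    ∃ CJ : ℝ, 0 ≤ CJ ∧ ∀ N : ℕ,
      ∫ z, (∑ i : Fin N, (pinnedChain ω₂ lam β γ).bondCurrent N i z) ^ 2 ∂((pinnedChain ω₂ lam β γ).gibbsMeasure N T) ≤
        CJ * (N : ℝ) := by
  obtain ⟨CJ, hCJ0, hJb⟩ := exists_totalCurrent_sq_le hω hl.le hβ.le γ hT
  refine ⟨CJ, hCJ0, fun N => ?_⟩
  have hw := hJb N
  have hZpos := OddResponseBound.Intensive.integral_gibbsWeight_pos hω hl.le hβ.le γ N hT
  rw [OddResponseBound.Intensive.integral_eq_toReal_mul_of_eq_smul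
    (OddResponseBound.Intensive.withDensity_gibbs_eq_smul_gibbsMeasure hω hl.le hβ.le γ N hT), ENNReal.toReal_ofReal hZpos.le] at hw
  refine le_of_mul_le_mul_left ?_ hZpos
  calc (∫ x : PhaseSpace N, Real.exp (-((pinnedChain ω₂ lam β γ).hamiltonian N x) / T)) *
        ∫ z, (∑ i : Fin N, (pinnedChain ω₂ lam β γ).bondCurrent N i z) ^ 2 ∂((pinnedChain ω₂ lam β γ).gibbsMeasure N T)
      ≤ CJ * (N : ℝ) * ∫ x : PhaseSpace N, Real.exp (-((pinnedChain ω₂ lam β γ).hamiltonian N x) / T) := hw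
    _ = _ := by ring

/-- ★ Lower statics on `μ_T^N` (probability): **the current's norm is extensive**, `c N ≤ ‖J‖²_{μ_T^N}` for `N ≥ 3` with `c = c(ω₂,lam,β,T) > 0`
(tree: `ChainVariation.pinnedChain_integral_totalCurrent_sq_ge` via `OddCorrectorBathLocality.exists_const_currentNormSq_ge`, transported to `μ_T`). [folklore] -/
theorem exists_integral_totalCurrent_sq_gibbsMeasure_ge (hω : 0 < ω₂) (hl : 0 < lam) (hβ : 0 < β) (hT : 0 < T) :
    ∃ c : ℝ, 0 < c ∧ ∀ N : ℕ, 3 ≤ N →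
      c * (N : ℝ) ≤
        ∫ z, (∑ i : Fin N, (pinnedChain ω₂ lam β γ).bondCurrent N i z) ^ 2 ∂((pinnedChain ω₂ lam β γ).gibbsMeasure N T) := by
  obtain ⟨c, hc0, hc⟩ := OddCorrectorBathLocality.exists_const_currentNormSq_ge hω hl.le hβ.le γ hT
  refine ⟨c / 3, by positivity, fun N hN3 => ?_⟩
  obtain ⟨n, rfl⟩ : ∃ n, N = n + 3 := ⟨N - 3, by omega⟩
  have h := hc n
  have hZpos := OddResponseBound.Intensive.integral_gibbsWeight_pos hω hl.le hβ.le γ (n + 3) hT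
  have hsmul := OddResponseBound.Intensive.withDensity_gibbs_eq_smul_gibbsMeasure hω hl.le hβ.le γ (n + 3) hT
  haveI : IsProbabilityMeasure ((pinnedChain ω₂ lam β γ).gibbsMeasure (n + 3) T) :=
    pinnedChain_isProbabilityMeasure_gibbsMeasure hω hl.le hβ.le γ (n + 3) hT
  set Z := ∫ x : PhaseSpace (n + 3), Real.exp (-((pinnedChain ω₂ lam β γ).hamiltonian (n + 3) x) / T) with hZ
  set M := ∫ z, (∑ i : Fin (n + 3), (pinnedChain ω₂ lam β γ).bondCurrent (n + 3) i z) ^ 2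
    ∂((pinnedChain ω₂ lam β γ).gibbsMeasure (n + 3) T) with hM
  have h1 : OddSectorLocality.currentNormSq ω₂ lam β γ T (n + 3) = Z * M := by
    unfold OddSectorLocality.currentNormSq OddSectorLocality.gibbsWeight
    rw [OddResponseBound.Intensive.integral_eq_toReal_mul_of_eq_smul hsmul, ENNReal.toReal_ofReal hZpos.le]
  have h2 : (OddSectorLocality.gibbsWeight ω₂ lam β γ T (n + 3) univ).toReal = Z := by
    unfold OddSectorLocality.gibbsWeight
    rw [hsmul, Measure.smul_apply, measure_univ, smul_eq_mul, mul_one, ENNReal.toReal_ofReal hZpos.le]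
  rw [h2, h1] at h
  have h3 : c * ((n : ℝ) + 1) ≤ M := by
    refine le_of_mul_le_mul_left ?_ hZpos
    calc Z * (c * ((n : ℝ) + 1)) = c * ((n : ℝ) + 1) * Z := by ring
      _ ≤ Z * M := h
  calc c / 3 * ((n + 3 : ℕ) : ℝ) = c / 3 * ((n : ℝ) + 3) := by push_cast; ring
    _ ≤ c * ((n : ℝ) + 1) := by nlinarith [hc0, Nat.cast_nonneg (α := ℝ) n]
    _ ≤ M := h3

/-! ## §2 The two halves of the split (the equivalence is assembled in §4) -/

/-- (Oᶜ_s) ⟹ (OTᶜ_s): the transversal part is at most the whole. [frame] -/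
theorem oddTransversalGrade_of_oddCorrectorGrade {s : ℝ} (hO : OddCorrectorGrade s) : OddTransversalGrade s := by
  intro ω₂ lam β γ hω hl hβ hγ T hT
  obtain ⟨C, N₀, hC⟩ := hO ω₂ lam β γ hω hl hβ hγ T hT
  refine ⟨C, N₀, fun N hN hN₀ => (sub_le_self _ (sq_nonneg _)).trans ?_⟩
  exact mul_le_mul_of_nonneg_right (hC N hN hN₀) (integral_nonneg fun _ => sq_nonneg _)

/-- ★ (JCᶜ_s) ∧ (OTᶜ_s) ⟹ (Oᶜ_s): Pythagoras plus the current floor `‖J‖²_{μ_T^N} ≥ cN > 0` (§1) to divide by `‖J‖²`. [folklore] -/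
theorem oddCorrectorGrade_of_component_transversal {s : ℝ} (hJ : CurrentComponentGrade s) (hOT : OddTransversalGrade s) :
    OddCorrectorGrade s := by
  intro ω₂ lam β γ hω hl hβ hγ T hT
  obtain ⟨C₁, N₁, h₁⟩ := hJ ω₂ lam β γ hω hl hβ hγ T hT
  obtain ⟨C₂, N₂, h₂⟩ := hOT ω₂ lam β γ hω hl hβ hγ T hT
  obtain ⟨c, hc0, hc⟩ := exists_integral_totalCurrent_sq_gibbsMeasure_ge (γ := γ) hω hl hβ hT
  refine ⟨C₁ + C₂, max (max N₁ N₂) 3, fun N hN hN₀ => ?_⟩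
  have hN₁ : N₁ ≤ N := le_trans (le_trans (le_max_left _ _) (le_max_left _ _)) hN₀
  have hN₂ : N₂ ≤ N := le_trans (le_trans (le_max_right _ _) (le_max_left _ _)) hN₀
  have hN3 : 3 ≤ N := le_trans (le_max_right _ _) hN₀
  set M := ∫ z, (∑ i : Fin N, (pinnedChain ω₂ lam β γ).bondCurrent N i z) ^ 2 ∂((pinnedChain ω₂ lam β γ).gibbsMeasure N T) with hM
  have hMpos : 0 < M := lt_of_lt_of_le (mul_pos hc0 (by exact_mod_cast hN)) (hc N hN3)
  refine le_of_mul_le_mul_right ?_ hMpos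
  calc oddDefect ((pinnedChain ω₂ lam β γ).gibbsMeasure N T) (kinCorrector ω₂ lam β γ T N ⟨0, hN⟩) * M
      ≤ C₁ * (N : ℝ) ^ s * M + C₂ * (N : ℝ) ^ s * M := by linarith [h₁ N hN hN₁, h₂ N hN hN₂]
    _ = (C₁ + C₂) * (N : ℝ) ^ s * M := by ring

/-! ## §3 The J-component IS the rung: `(JCᶜ_s) ⟺ F((1−s)/2)` -/

/-- (JCᶜ_s) ⟹ `ExponentFloor ((1−s)/2)`: `E_N² = ⟨h₀−h₀∘Θ,J⟩²/(4T⁴(N−1)²) ≤ C N^s · C_J N/(4T⁴(N−1)²) ≤ K N^{s−1}`. [folklore] -/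
theorem exponentFloor_of_currentComponentGrade {s : ℝ} (hJ : CurrentComponentGrade s) : ExponentFloor ((1 - s) / 2) := by
  intro ω₂ lam β γ hω hl hβ hγ T hT
  obtain ⟨C, N₀, hC⟩ := hJ ω₂ lam β γ hω hl hβ hγ T hT
  obtain ⟨CJ, hCJ0, hJb⟩ := exists_integral_totalCurrent_sq_gibbsMeasure_le (γ := γ) hω hl hβ hT
  refine ⟨Real.sqrt (max C 0 * CJ / T ^ 4), max N₀ 2, fun N hN => ?_⟩
  have hN2 : 2 ≤ N := le_trans (le_max_right _ _) hN
  have hN₀ : N₀ ≤ N := le_trans (le_max_left _ _) hN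
  have hNpos : 0 < N := by omega
  have hn2 : (2 : ℝ) ≤ N := by exact_mod_cast hN2
  have hn0 : (0 : ℝ) < N := by linarith
  have hN1 : (0 : ℝ) < (N : ℝ) - 1 := by linarith
  have hE := escapeDeficit_eq_oddCorrector_current_pairing hω hl hβ hγ hT hN2
  set I := ∫ z, (kinCorrector ω₂ lam β γ T N ⟨0, hNpos⟩ z - kinCorrector ω₂ lam β γ T N ⟨0, hNpos⟩ (z.1, -z.2)) *
      (∑ i : Fin N, (pinnedChain ω₂ lam β γ).bondCurrent N i z) ∂((pinnedChain ω₂ lam β γ).gibbsMeasure N T) with hI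
  set M := ∫ z, (∑ i : Fin N, (pinnedChain ω₂ lam β γ).bondCurrent N i z) ^ 2 ∂((pinnedChain ω₂ lam β γ).gibbsMeasure N T) with hM
  have hM0 : 0 ≤ M := integral_nonneg fun _ => sq_nonneg _
  have hNs : 0 ≤ (N : ℝ) ^ s := Real.rpow_nonneg hn0.le s
  have hI2 : I ^ 2 ≤ max C 0 * (N : ℝ) ^ s * (CJ * (N : ℝ)) :=
    calc I ^ 2 ≤ C * (N : ℝ) ^ s * M := hC N hNpos hN₀
      _ ≤ max C 0 * (N : ℝ) ^ s * M := mul_le_mul_of_nonneg_right (mul_le_mul_of_nonneg_right (le_max_left _ _) hNs) hM0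
      _ ≤ max C 0 * (N : ℝ) ^ s * (CJ * (N : ℝ)) := mul_le_mul_of_nonneg_left (hJb N) (by positivity)
  have hfrac : (N : ℝ) / ((N : ℝ) - 1) ^ 2 ≤ 4 / (N : ℝ) := by
    rw [div_le_div_iff₀ (by nlinarith) hn0]
    nlinarith
  have h2 : escapeDeficit ω₂ lam β γ T N ^ 2 ≤ max C 0 * CJ / T ^ 4 * (N : ℝ) ^ (s - 1) := by
    calc escapeDeficit ω₂ lam β γ T N ^ 2 = (1 / (4 * T ^ 4 * ((N : ℝ) - 1) ^ 2)) * I ^ 2 := by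
          rw [hE]
          field_simp
          ring
      _ ≤ (1 / (4 * T ^ 4 * ((N : ℝ) - 1) ^ 2)) * (max C 0 * (N : ℝ) ^ s * (CJ * (N : ℝ))) :=
          mul_le_mul_of_nonneg_left hI2 (by positivity)
      _ = max C 0 * CJ / (4 * T ^ 4) * (N : ℝ) ^ s * ((N : ℝ) / ((N : ℝ) - 1) ^ 2) := by
          field_simp
      _ ≤ max C 0 * CJ / (4 * T ^ 4) * (N : ℝ) ^ s * (4 / (N : ℝ)) := mul_le_mul_of_nonneg_left hfrac (by positivity)
      _ = max C 0 * CJ / T ^ 4 * ((N : ℝ) ^ s / (N : ℝ)) := by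
          field_simp
      _ = max C 0 * CJ / T ^ 4 * (N : ℝ) ^ (s - 1) := by rw [Real.rpow_sub_one hn0.ne']
  have hsq : Real.sqrt (max C 0 * CJ / T ^ 4 * (N : ℝ) ^ (s - 1)) =
      Real.sqrt (max C 0 * CJ / T ^ 4) / (N : ℝ) ^ ((1 - s) / 2) := by
    rw [Real.sqrt_mul (by positivity) ((N : ℝ) ^ (s - 1)), Real.sqrt_eq_rpow ((N : ℝ) ^ (s - 1)),
      ← Real.rpow_mul hn0.le, show (s - 1) * (1 / (2 : ℝ)) = -((1 - s) / 2) by ring, Real.rpow_neg hn0.le]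
    exact (div_eq_mul_inv _ _).symm
  calc escapeDeficit ω₂ lam β γ T N ≤ |escapeDeficit ω₂ lam β γ T N| := le_abs_self _
    _ ≤ Real.sqrt (max C 0 * CJ / T ^ 4 * (N : ℝ) ^ (s - 1)) := Real.abs_le_sqrt h2
    _ = Real.sqrt (max C 0 * CJ / T ^ 4) / (N : ℝ) ^ ((1 - s) / 2) := hsq

/-- ★ `ExponentFloor ((1−s)/2)` ⟹ (JCᶜ_s): `⟨h₀−h₀∘Θ,J⟩² = 4T⁴(N−1)²E_N² ≤ 4T⁴N²·C²N^{s−1} ≤ (4T⁴C²/c)·N^s·‖J‖²` by `0 ≤ E_N` and the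
current floor (§1).  So the J-component of an odd-norm statement is never more than the escape rung it lands on. [folklore] -/
theorem currentComponentGrade_of_exponentFloor {s : ℝ} (hF : ExponentFloor ((1 - s) / 2)) : CurrentComponentGrade s := by
  intro ω₂ lam β γ hω hl hβ hγ T hT
  obtain ⟨C, N₀, hC⟩ := hF ω₂ lam β γ hω hl hβ hγ T hT
  obtain ⟨c, hc0, hc⟩ := exists_integral_totalCurrent_sq_gibbsMeasure_ge (γ := γ) hω hl hβ hT
  refine ⟨4 * T ^ 4 * (max C 0) ^ 2 / c, max N₀ 3, fun N hN hN₀ => ?_⟩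
  have hN3 : 3 ≤ N := le_trans (le_max_right _ _) hN₀
  have hN₀' : N₀ ≤ N := le_trans (le_max_left _ _) hN₀
  have hN2 : 2 ≤ N := by omega
  have hn3 : (3 : ℝ) ≤ N := by exact_mod_cast hN3
  have hn0 : (0 : ℝ) < N := by linarith
  have hE := escapeDeficit_eq_oddCorrector_current_pairing hω hl hβ hγ hT hN2
  set I := ∫ z, (kinCorrector ω₂ lam β γ T N ⟨0, hN⟩ z - kinCorrector ω₂ lam β γ T N ⟨0, hN⟩ (z.1, -z.2)) *
      (∑ i : Fin N, (pinnedChain ω₂ lam β γ).bondCurrent N i z) ∂((pinnedChain ω₂ lam β γ).gibbsMeasure N T) with hI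
  set M := ∫ z, (∑ i : Fin N, (pinnedChain ω₂ lam β γ).bondCurrent N i z) ^ 2 ∂((pinnedChain ω₂ lam β γ).gibbsMeasure N T) with hM
  have hMc : c * (N : ℝ) ≤ M := hc N hN3
  have hE0 : 0 ≤ escapeDeficit ω₂ lam β γ T N := escapeDeficit_nonneg' hω hl hβ hγ hT hN2
  have hEa : escapeDeficit ω₂ lam β γ T N ≤ max C 0 / (N : ℝ) ^ ((1 - s) / 2) :=
    (hC N hN₀').trans (div_le_div_of_nonneg_right (le_max_left _ _) (Real.rpow_nonneg hn0.le _))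
  have hIeq : I = -(2 * T ^ 2 * ((N : ℝ) - 1)) * escapeDeficit ω₂ lam β γ T N := by
    rw [hE]
    have hN1 : (N : ℝ) - 1 ≠ 0 := by linarith
    field_simp
  have hE2 : escapeDeficit ω₂ lam β γ T N ^ 2 * (N : ℝ) ^ (1 - s) ≤ (max C 0) ^ 2 := by
    have hNa : 0 < (N : ℝ) ^ ((1 - s) / 2) := Real.rpow_pos_of_pos hn0 _
    have h1 : escapeDeficit ω₂ lam β γ T N * (N : ℝ) ^ ((1 - s) / 2) ≤ max C 0 := by
      rw [← le_div_iff₀ hNa]; exact hEa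
    have h1' : 0 ≤ escapeDeficit ω₂ lam β γ T N * (N : ℝ) ^ ((1 - s) / 2) := mul_nonneg hE0 hNa.le
    have hsq := mul_self_le_mul_self h1' h1
    have hpow' : ((N : ℝ) ^ ((1 - s) / 2)) ^ 2 = (N : ℝ) ^ (1 - s) := by
      rw [← Real.rpow_natCast, ← Real.rpow_mul hn0.le]
      congr 1
      push_cast
      ring
    nlinarith [hsq, hpow']
  have hNs : 0 < (N : ℝ) ^ s := Real.rpow_pos_of_pos hn0 s
  have hsplit : (N : ℝ) ^ (1 - s) * (N : ℝ) ^ s = (N : ℝ) := by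
    rw [← Real.rpow_add hn0, show 1 - s + s = (1 : ℝ) by ring, Real.rpow_one]
  -- `I² = 4T⁴(N−1)²E² ≤ 4T⁴ N² E²` and `E² ≤ (max C 0)² N^{s-1}`, `N ≤ M/c`
  have hI2 : I ^ 2 ≤ 4 * T ^ 4 * (N : ℝ) ^ 2 * escapeDeficit ω₂ lam β γ T N ^ 2 := by
    rw [hIeq, show (-(2 * T ^ 2 * ((N : ℝ) - 1)) * escapeDeficit ω₂ lam β γ T N) ^ 2 =
      4 * T ^ 4 * ((N : ℝ) - 1) ^ 2 * escapeDeficit ω₂ lam β γ T N ^ 2 by ring]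
    have hN1sq : ((N : ℝ) - 1) ^ 2 ≤ (N : ℝ) ^ 2 := by nlinarith
    exact mul_le_mul_of_nonneg_right (mul_le_mul_of_nonneg_left hN1sq (by positivity)) (sq_nonneg _)
  calc I ^ 2 ≤ 4 * T ^ 4 * (N : ℝ) ^ 2 * escapeDeficit ω₂ lam β γ T N ^ 2 := hI2
    _ = 4 * T ^ 4 * (N : ℝ) * (escapeDeficit ω₂ lam β γ T N ^ 2 * (N : ℝ) ^ (1 - s)) * (N : ℝ) ^ s := by
        rw [show (4 : ℝ) * T ^ 4 * (N : ℝ) * (escapeDeficit ω₂ lam β γ T N ^ 2 * (N : ℝ) ^ (1 - s)) * (N : ℝ) ^ s =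
          4 * T ^ 4 * (N : ℝ) * escapeDeficit ω₂ lam β γ T N ^ 2 * ((N : ℝ) ^ (1 - s) * (N : ℝ) ^ s) by ring, hsplit]
        ring
    _ ≤ 4 * T ^ 4 * (N : ℝ) * (max C 0) ^ 2 * (N : ℝ) ^ s := by
        have := mul_le_mul_of_nonneg_left hE2 (by positivity : (0 : ℝ) ≤ 4 * T ^ 4 * (N : ℝ))
        nlinarith [this, hNs]
    _ = 4 * T ^ 4 * (max C 0) ^ 2 / c * (N : ℝ) ^ s * (c * (N : ℝ)) := by
        field_simp
    _ ≤ 4 * T ^ 4 * (max C 0) ^ 2 / c * (N : ℝ) ^ s * M :=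
        mul_le_mul_of_nonneg_left hMc (by positivity)

/-- **THE J-COMPONENT IS THE RUNG.** `CurrentComponentGrade s ↔ ExponentFloor ((1−s)/2)`. [folklore] -/
theorem currentComponentGrade_iff_exponentFloor (s : ℝ) : CurrentComponentGrade s ↔ ExponentFloor ((1 - s) / 2) :=
  ⟨exponentFloor_of_currentComponentGrade, currentComponentGrade_of_exponentFloor⟩

/-! ## §4 The honesty equivalences -/

/-- (Oᶜ_s) ⟹ (JCᶜ_s), through the rung: `exponentFloor_of_oddCorrectorGrade` (gen 102, Cauchy–Schwarz) then §3. [frame] -/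
theorem currentComponentGrade_of_oddCorrectorGrade {s : ℝ} (hO : OddCorrectorGrade s) : CurrentComponentGrade s :=
  currentComponentGrade_of_exponentFloor (exponentFloor_of_oddCorrectorGrade hO)

/-- **SPLIT (Pythagoras).** `OddCorrectorGrade s ↔ CurrentComponentGrade s ∧ OddTransversalGrade s`. [folklore] -/
theorem oddCorrectorGrade_iff_component_transversal (s : ℝ) :
    OddCorrectorGrade s ↔ CurrentComponentGrade s ∧ OddTransversalGrade s :=
  ⟨fun h => ⟨currentComponentGrade_of_oddCorrectorGrade h, oddTransversalGrade_of_oddCorrectorGrade h⟩,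
    fun h => oddCorrectorGrade_of_component_transversal h.1 h.2⟩

/-- ★★ **GRADED HONESTY EQUIV.** `OddCorrectorGrade s ↔ ExponentFloor ((1−s)/2) ∧ OddTransversalGrade s` for every real `s`:
an odd-NORM rung is EXACTLY its escape rung plus a transversal smallness. [folklore] -/
theorem oddCorrectorGrade_iff_exponentFloor_and_transversal (s : ℝ) :
    OddCorrectorGrade s ↔ ExponentFloor ((1 - s) / 2) ∧ OddTransversalGrade s :=
  ⟨fun h => ⟨exponentFloor_of_oddCorrectorGrade h, oddTransversalGrade_of_oddCorrectorGrade h⟩,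
    fun h => oddCorrectorGrade_of_component_transversal (currentComponentGrade_of_exponentFloor h.1) h.2⟩

/-- ★★★ **HONESTY OF DOOR 102D.** `OddCorrectorGrade (−1) ↔ BoundedResponse ∧ OddTransversalGrade (−1)`: the intensive-odd-corrector door is
11071 itself PLUS (OT₋₁ᶜ) `dist²(h₀^odd, ℝJ) = O(1/N)` — which norm persistence predicts FALSE (`dist² ≍ 1`).  102D is therefore a door only
if the instrument contradicts the prediction; otherwise it is DORMANT and 11071 is untouched by it. [folklore] -/
theorem oddCorrectorGrade_neg_one_iff : OddCorrectorGrade (-1) ↔ BoundedResponse ∧ OddTransversalGrade (-1) := by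
  rw [oddCorrectorGrade_iff_exponentFloor_and_transversal, ← exponentFloor_one_iff_boundedResponse]
  norm_num

/-- ★ **THE CEILING RUNG.** `OddCorrectorGrade 0 ↔ HalfOhmicFloor ∧ OddTransversalGrade 0`: an `N`-free odd defect is `F(1/2)` plus
`dist²(h₀^odd, ℝJ) = O(1)` — both predicted TRUE (borderline); `F(1/2)` is where every odd-norm / Cauchy–Schwarz ladder lands. [folklore] -/
theorem oddCorrectorGrade_zero_iff : OddCorrectorGrade 0 ↔ HalfOhmicFloor ∧ OddTransversalGrade 0 := by
  have h := oddCorrectorGrade_iff_exponentFloor_and_transversal 0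
  norm_num at h
  exact h

/-- E1 `ConeScaleCorrector` ⟹ (OTᶜ_0) (through `oddCorrectorGrade_zero_of_coneScaleCorrector`). [frame] -/
theorem oddTransversalGrade_zero_of_coneScaleCorrector (hE : ConeScaleCorrector) : OddTransversalGrade 0 :=
  oddTransversalGrade_of_oddCorrectorGrade (oddCorrectorGrade_zero_of_coneScaleCorrector hE)

end OddTransversality

end Summit.AtomisticToContinuum.FouriersLaw.Theorems.BoundedResponse.ParityFloor

end
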